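import Summits.BirchSwinnertonDyer.BirchSwinnertonDyer.Theorems.UniversalToricDescentTwinFramesAtThreeOfTresSelfDual
import Summits.BirchSwinnertonDyer.BirchSwinnertonDyer.Theorems.UniversalToricDescentToricKernelAtThreeDegreeOnlyTwinOfPrint
import HarnessLib

/-!
# SKELETON PROPOSAL v16T (line `membertower`, crux ♭B′ `TwinWanFrameAtThreeMultTresT` = stmt-BirchSwinnertonDyer-27401, with the
# ♭B′° 22539 mirror; width seat bsd-wall-utd-b-w1 g4, 2026-08-29) — v16 RE-KEYED after the pen's restatement T2 (route rev 79):
# research stub := K1♯†_T = item stmt-BirchSwinnertonDyer-24017 VERBATIM (3059 ch); NOT registered here (crux LEAD's single slot)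

WHY: the skeleton of record on 27401 (v16, LEAD utd-p2 g18, 8c09f9fed2825b17) carries `stub_selfDualMemberRationalInclusionAtThree` := the
rev-78 text of item 23310 (K1♯†, 3011 ch, NO très-ramifié binder). At T2 (pen pss3x g7, 02:36:45Z, rev 79) 23310 was RETIRED and replaced by
item 24017 `TwinSelfDualMemberRationalInclusionAtThree` = K1♯†_T (= old text + `¬ 3 ∣ padicValInt 3 W'.minimalDiscriminantInt →` after
`Odd (NumberField.discr K) →`). The old stub text is STRONGER than the new item (it also covers the peu-ramifié corner K1♯†_peu, which no consumer
reads and no road supplies: p690769 §3 is old ⟹ new only), so after T2 the registered research stub of 27401 is keyed to NO item and is NOT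
closed by closing 24017. v16T = v16 with that one stub retyped to 24017's text (what ♭B′ — a très-ramifié statement — actually consumes) and the
composition moved from (5)† to its K1♯†_T-weakened twin p682999 §7. Companion of `Cruxes/TwinDegreeFrameAtThreeMultTresT/Lines/membertower_v17T_proposal.lean`
(22539 ONLY, 2 stubs, no Thm B — director GO 02:53:14Z); on 27401 Hsieh Thm B stays load-bearing (rational Wan inclusion needs `μ(L) = 0`).
Three stubs:

* `stub_thmB` := `Hsieh2014.thmB_exists_isHsiehLFunction_coeff_norm_eq_one_unrPeriod_anyLevel` (item 20711, PUB BY NAME) — v16 VERBATIM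
  (kernel-shortcut audit: `Cruxes/TwinDegreeFrameAtThreeMultTresT/B3-STUBTHMB-KERNEL-AUDIT-utd-b-w1-g4.md` — none; closes only by formalisation).
* `stub_pubMembersFramesCongruence` := `Castella2018.castella2020_thm211_members_frames_sigma_congruence_odd_nonsplit_wt` (item 23284, PUB BY NAME) — v16 VERBATIM.
* `stub_tresSelfDualMemberRationalInclusionAtThree` := K1♯†_T = item 24017's text VERBATIM (RESEARCH; closable from TV₃† by ONE name:
  p690769 §1 `twinSelfDualMemberRationalInclusionAtThree_of_twoVarCoreAtThreeDagger` / p682284 §2 `tresSelfDual_of_twoVarCoreAtThreeDagger`).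

Composition: `TwinWanFrameAtThreeMultTresT_of` := p682999 §7
`UniversalToricDescentTwinFramesAtThreeOfTresSelfDual.twinWanFrameAtThreeMultTresT_of_thmB_of_nonsplitWtMembersFrames_of_tresSelfDual`;
mirror `TwinDegreeFrameAtThreeMultTresT_of` := p640116 §4 `twinDegreeFrameMultTresT_of_wanFrame` ∘ it (as v16; for 22539 itself prefer v17T,
which needs no Thm B). lean rc 0 expected with exactly 3 sorries (the stubs); both cruxes concluded BY NAME.
BSD is not proved by any of this; every `sorry` below is a stub.
[cite: Hsieh2014, Thm. B p. 712] [cite: Castella2020JIMJ, Thm. 2.11] [cite: Castella2018Erratum, §2 (p. 2), Lemma 2.1, proof of Thm. 1.1 (a)(b)(c)]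
[cite: Skinner2016PacificMC, §2.6 (2-6-1), §3.1]
-/

noncomputable section

open scoped Classical

set_option linter.dupNamespace false
set_option autoImplicit false

namespace Summit.BirchSwinnertonDyer.BirchSwinnertonDyer.Cruxes.TwinWanFrameAtThreeMultTresT.MemberTower

open PowerSeries WeierstrassCurve NumberField IsDedekindDomain Field
  Literature.NumberTheory.EllipticCurves
  Literature.NumberTheory.EllipticCurves.ModularForms
  Literature.NumberTheory.EllipticCurves.Rank1Residual
  Literature.NumberTheory.EllipticCurves.BigGaloisRep
  Literature.NumberTheory.EllipticCurves.GreenbergSelmer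
  Literature.NumberTheory.GaloisRepresentations
  Summit.BirchSwinnertonDyer.Rank1Residual.X11b
  Summit.BirchSwinnertonDyer.Rank1Residual.X11b.Halves
  Summit.BirchSwinnertonDyer.BirchSwinnertonDyer.Theorems.SchneiderFree
  Summit.BirchSwinnertonDyer.BirchSwinnertonDyer.Theses.UniversalToricDescent

/-- STUB (BY NAME = item stmt-BirchSwinnertonDyer-20711 `HsiehMuInvariantInput`; PUBLISHED; closes only by formalisation):
Hsieh 2014 Thm. B at every level — `μ = 0` of the anticyclotomic `p`-adic `L`-function, `p`-adic period in `R₀ˣ`.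
[cite: Hsieh2014, Thm. B p. 712 (Doc. Math. 19)] -/
theorem stub_thmB : Hsieh2014.thmB_exists_isHsiehLFunction_coeff_norm_eq_one_unrPeriod_anyLevel := by
  sorry

/-- STUB (BY NAME = item stmt-BirchSwinnertonDyer-23284 `TwinCastellaMembersFramesCongruenceOddInput` at route rev 72, the
weight-sharpened supply 22593†; PUBLISHED by reading; closes only by formalisation): Castella JIMJ 2020 §2 Def. 2.10 / Thm. 2.11 at
an odd prime WITH the erratum's hypothesis (iii), members chosen with `2(p−1)p^{m−1} ∣ k_m − 2` (free in print: Skinner 2016 §2.6).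
[cite: Castella2020JIMJ, §2 Def. 2.10, Thm. 2.11] [cite: Castella2018Erratum, Thm. 1.1 (iii), proof (a)(b)] [cite: Skinner2016PacificMC, §2.6 (2-6-1), §3.1] -/
theorem stub_pubMembersFramesCongruence :
    Castella2018.castella2020_thm211_members_frames_sigma_congruence_odd_nonsplit_wt := by
  sorry

/-- STUB (RESEARCH, hardest stub) **K1♯†_T** = item stmt-BirchSwinnertonDyer-24017 `TwinSelfDualMemberRationalInclusionAtThree` VERBATIM
(route rev 79; 3059 ch). For every twin `W′` multiplicative and très ramifié at `3` with `ρ̄₃` onto, all-split Heegner `K` of odd discriminant,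
anticyclotomic `κ`, degree-one `𝔭 ∣ 3` with other slot `𝔭′`, branch-compatible `ι′`: for every depth `m ≥ 1`, every Hida member `D` with
`2(3−1)3^{m−1} ∣ k_m − 2` and `ρ̄` irreducible, `ι′`-compatible, every characterised receptacle `b`, every Σ-frame `(Ω_K ≠ 0, Ω_p ∈ 𝓞_{ℂ₃}ˣ, Q)`:
`X^Σ_ac(A†_{g_m}; 𝔭′)` torsion ⟹ `∃ e, (3^e)·Ch(X^Σ_ac(A†_{g_m}))·𝓞_{ℂ₃}⟦T⟧ ⊆ (Q)` on the SELF-DUAL Tate twist. Closable by ONE name from TV₃†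
(p690769 §1). No printed engine at `p = 3`. [cite: Castella2018Erratum, §2 (p. 2), (2.5)] [cite: JetchevSkinnerWan2017, §3.4, Cor. 3.4.2]
[cite: SkinnerUrban2014, Thm. 3.26, Prop. 3.23] -/
theorem stub_tresSelfDualMemberRationalInclusionAtThree :
  ∀ (W' : WeierstrassCurve ℚ) [W'.IsElliptic] [W'.IsGloballyMinimal] (N' : ℕ) [NeZero N'] (K : Type) [Field K] [NumberField K] (Dt' : Literature.NumberTheory.EllipticCurves.ModularForms.ModularParametrizationData W' N'), Literature.NumberTheory.EllipticCurves.Rank1Residual.Mult W' 3 → W'.HasSurjectiveModNGaloisRep 3 → W'.conductorNorm ℤ = N' → Literature.NumberTheory.EllipticCurves.IsImaginaryQuadratic K → Literature.NumberTheory.EllipticCurves.SatisfiesHeegnerHypothesis N' K → Odd (NumberField.discr K) → ¬ 3 ∣ padicValInt 3 W'.minimalDiscriminantInt → ∀ (κ : Literature.NumberTheory.EllipticCurves.ZpExtension K 3), κ.IsAnticyclotomic → ∀ (γ : Field.absoluteGaloisGroup K) [Fact (κ.IsTopGenerator γ)] (𝔭 : IsDedekindDomain.HeightOneSpectrum (NumberField.RingOfIntegers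 K)), ((3 : ℕ) : NumberField.RingOfIntegers K) ∈ 𝔭.asIdeal → 𝔭.asIdeal.ramificationIdx (NumberField.RingOfIntegers ℚ) = 1 → 𝔭.asIdeal.inertiaDeg (NumberField.RingOfIntegers ℚ) = 1 → ∀ (𝔭' : IsDedekindDomain.HeightOneSpectrum (NumberField.RingOfIntegers K)), ((3 : ℕ) : NumberField.RingOfIntegers K) ∈ 𝔭'.asIdeal → 𝔭' ≠ 𝔭 → ∀ (ι' : PadicAlgCl 3 ≃+* ℂ), Summit.BirchSwinnertonDyer.BirchSwinnertonDyer.Theorems.SchneiderFree.BranchInducesPrime 3 ι' 𝔭 → ∀ (m : ℕ), 1 ≤ m → ∀ (D : Literature.NumberTheory.EllipticCurves.Skinner2016.HidaCongruentMember W' 3 m), (2 * (((3 : ℕ) : ℤ) - 1) * ((3 : ℕ) : ℤ) ^ (m - 1)) ∣ D.k - 2 → Literature.NumberTheory.EllipticCurves.SkinnerUrban2014.IsResiduallyIrreducible D.Δ → (∀ x : Literature.NumberTheory.EllipticCurves.ModularForms.coeffField D.g, ι' (D.ι x) = (x : ℂ)) → ∀ (b : Literature.NumberTheory.EllipticCurves.GreenbergSelmer.padicCoeffIntegers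 D.ι →+* 𝓞_ℂ_[3]), (∀ x, ((b x : 𝓞_ℂ_[3]) : ℂ_[3]) = algebraMap (PadicAlgCl 3) ℂ_[3] (Literature.NumberTheory.EllipticCurves.GreenbergSelmer.padicCoeffIntegers.toPadicAlgCl D.ι x)) → ∀ (ΩK : ℂ) (Ωp : (𝓞_ℂ_[3])ˣ) (Q : PowerSeries 𝓞_ℂ_[3]), ΩK ≠ 0 → Literature.NumberTheory.EllipticCurves.IsBDPLFunctionWtSigmaInt ι' 𝔭 κ γ D.g (W'.sigmaPlacesFinset 3 K) ΩK ((Ωp : 𝓞_ℂ_[3]) : ℂ_[3]) Q → ∀ [TopologicalSpace (PowerSeries (Literature.NumberTheory.EllipticCurves.GreenbergSelmer.padicCoeffIntegers D.ι))] [ContinuousSMul (PowerSeries (Literature.NumberTheory.EllipticCurves.GreenbergSelmer.padicCoeffIntegers D.ι)) (Literature.NumberTheory.EllipticCurves.BigRepModule (Literature.NumberTheory.EllipticCurves.GreenbergSelmer.padicCoeffIntegers D.ι) 3 (Literature.NumberTheory.EllipticCurves.GreenbergSelmer.Cofree D.Δ.selfDualRep (Literature.NumberTheory.EllipticCurves.GreenbergSelmer.padicCoeffField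 D.ι)))], Module.IsTorsion (PowerSeries (Literature.NumberTheory.EllipticCurves.GreenbergSelmer.padicCoeffIntegers D.ι)) (Literature.NumberTheory.EllipticCurves.BigGaloisRep.XBig κ (D.Δ.selfDualCofreeRepOver K) 𝔭' (↑(W'.sigmaPlacesFinset 3 K))) → ∃ e : ℕ, Ideal.span {(PowerSeries.C ((3 : ℕ) : 𝓞_ℂ_[3]) : PowerSeries 𝓞_ℂ_[3]) ^ e} * (Literature.NumberTheory.EllipticCurves.BigGaloisRep.XBig.charIdeal κ (D.Δ.selfDualCofreeRepOver K) 𝔭' (↑(W'.sigmaPlacesFinset 3 K))).map (PowerSeries.map b) ≤ Ideal.span {Q} := by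
  sorry

/-- COMPOSITION (v16T): ♭B′ `TwinWanFrameAtThreeMultTresT` (item stmt-BirchSwinnertonDyer-27401) BY NAME from the THREE stubs through
p682999 §7 (Hsieh Thm B for `μ(L) = 0`, supply frame from the fact†, self-dual member tower with inclusions from K1♯†_T applied at the
très-ramifié twin, (dec) from the binder). [folklore] -/
theorem TwinWanFrameAtThreeMultTresT_of :
    Summit.BirchSwinnertonDyer.BirchSwinnertonDyer.Theses.UniversalToricDescent.TwinWanFrameAtThreeMultTresT :=
  Summit.BirchSwinnertonDyer.BirchSwinnertonDyer.Theorems.UniversalToricDescentTwinFramesAtThreeOfTresSelfDual.twinWanFrameAtThreeMultTresT_of_thmB_of_nonsplitWtMembersFrames_of_tresSelfDual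
    stub_thmB stub_pubMembersFramesCongruence stub_tresSelfDualMemberRationalInclusionAtThree

/-- COMPOSITION (mirror, act DEG): ♭B′° `TwinDegreeFrameAtThreeMultTresT` (item stmt-BirchSwinnertonDyer-22539) BY NAME from
`TwinWanFrameAtThreeMultTresT_of` and the landed monotonicity ♭B′ ⟹ ♭B′° (p640116 §4). For 22539 alone prefer v17T (2 stubs, no Thm B).
[folklore] -/
theorem TwinDegreeFrameAtThreeMultTresT_of :
    Summit.BirchSwinnertonDyer.BirchSwinnertonDyer.Theses.UniversalToricDescent.TwinDegreeFrameAtThreeMultTresT :=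
  Summit.BirchSwinnertonDyer.BirchSwinnertonDyer.Theorems.UniversalToricDescentKernelDegreeOnlyTwinOfPrint.twinDegreeFrameMultTresT_of_wanFrame
    TwinWanFrameAtThreeMultTresT_of

end Summit.BirchSwinnertonDyer.BirchSwinnertonDyer.Cruxes.TwinWanFrameAtThreeMultTresT.MemberTower

end
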